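import Mathlib
import HarnessLib
import Literature.Analysis.FluidPDE.WaveKineticCollisionBounds
import Summits.NavierStokesRegularity.NavierStokesRegularity.Theorems.CompletionRelayChainDefs

/-!
# `CompletionRelayChain` — crux `RelayFrontStep` (item stmt-NavierStokesRegularity-24850):
  WAKE RATES — scalar and algebraic bookkeeping for the far-wake stub `stub_wake` of LINE `window_v2`

The registered stub `stub_wake` (file `…RelayFrontStepStubWake.lean`) runs a one-sided uniform bootstrap over the
wake energies `F_{i,j}`, `i ∈ {0,1,2}`, `j ≤ −4`, with scales `wakeE i j = ½C_i²·2^{−j}` (`C = (0.2, 0.5, 0.08)`,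
`Theorems/CompletionRelayChainDefs.lean`). This file holds the flow-free ingredients:
* the amplitude scale `q = 2^{−j/2}` of a shell (`q² = 2^{−j}`, `q² ≥ 16` for `j ≤ −4`, one shell up / down) and the
  clocks of the relay rows against it (`2^{5j/2} = q^{−5}`, `2^{5(j−1)/2} = 2^{−5/2}q^{−5}`, `2^{−5/2} ≤ 0.177`,
  clocks `≤ 1` at and below the front), `relayEnv₂ (−3) = 16`, the wake clause per mode and its two-sided size
  `0.0032·2^{−k} ≤ wakeE i k ≤ 0.125·2^{−k}` (active modes);
* the three ROW RATES (pure algebra): with `Λ = q^{−5}`, `0 ≤ Λ' ≤ 0.177q^{−5}` and the bootstrap amplitude bounds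
  `|x_j| ≤ 0.26q`, `|u_j| ≤ 0.65q`, `|r_j| ≤ 0.104q`, `|u_{j−1}| ≤ 0.92q`, `|r_{j−1}| ≤ 0.15q`, `|x_{j+1}|, |u_{j+1}| ≤ 1.5q`,
  the products `quadTerm·S` of the carrier / trigger / relay rows are `≤ 0.15/q²`, `≤ 0.75/q²`, `≤ 0.007/q²`
  (`wake_rate_carrier/trigger/relay`); and the CRUDE RATES `≤ 3M³` when every amplitude is `≤ M` and the clocks
  are `≤ 1` (`wake_crude_*`, for the uniform growth constant of the bootstrap).

No definitions. HONEST FRAMING: arithmetic of MODEL-lattice clause profiles and rows (Tao 2016 §4 vocabulary); helper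
for the crux, no stub credit; nothing here is a statement about the Navier–Stokes equations.
-/

noncomputable section

-- the summit-side namespace `Summit.NavierStokesRegularity.NavierStokesRegularity.…` (single-conjunct summit,
-- D-0017) repeats a component by design; the dupNamespace linter would flag every declaration.
set_option linter.dupNamespace false

open Set Literature.Analysis.FluidPDE Literature.Analysis.FluidPDE.TaoCascade
open Literature.Analysis.FluidPDE.WaveKinetic (abs_mul_three_le)

namespace Summit.NavierStokesRegularity.NavierStokesRegularity.Cruxes.RelayFrontStep.Window2

/-! ### Scalar facts: the amplitude scale `q = 2^{−j/2}` of a shell and the clocks -/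

/-- `(2^{−j/2})² = 2^{−j}`. -/
theorem wake_scale_sq (j : ℤ) : ((2 : ℝ) ^ (-(j : ℝ) / 2)) ^ 2 = (2 : ℝ) ^ (-(j : ℝ)) := by
  rw [← Real.rpow_natCast, ← Real.rpow_mul (by norm_num)]
  congr 1; push_cast; ring

/-- The clock of shell `j` against its amplitude scale: `2^{5j/2} = q^{−5}`. -/
theorem wake_clock_eq (j : ℤ) :
    (1 + 1 : ℝ) ^ ((5 : ℝ) * (j : ℝ) / 2) = 1 / ((2 : ℝ) ^ (-(j : ℝ) / 2)) ^ 5 := by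
  rw [show (1 + 1 : ℝ) = 2 by norm_num, ← Real.rpow_natCast, ← Real.rpow_mul (by norm_num), one_div,
    ← Real.rpow_neg (by norm_num)]
  congr 1; push_cast; ring

/-- The clock of shell `j − 1`: `2^{5(j−1)/2} = 2^{−5/2}·q^{−5}`. -/
theorem wake_clock_pred_eq (j : ℤ) :
    (1 + 1 : ℝ) ^ ((5 : ℝ) * ((j : ℝ) - 1) / 2) =
      (2 : ℝ) ^ (-(5 : ℝ) / 2) * (1 / ((2 : ℝ) ^ (-(j : ℝ) / 2)) ^ 5) := by
  rw [← wake_clock_eq, show (1 + 1 : ℝ) = 2 by norm_num, ← Real.rpow_add (by norm_num)]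
  congr 1; ring

/-- `2^{−5/2} ≤ 0.177`. -/
theorem two_rpow_neg_five_halves_le : (2 : ℝ) ^ (-(5 : ℝ) / 2) ≤ 177 / 1000 := by
  have hpos : 0 < (2 : ℝ) ^ (-(5 : ℝ) / 2) := Real.rpow_pos_of_pos (by norm_num) _
  have hsq : ((2 : ℝ) ^ (-(5 : ℝ) / 2)) ^ 2 = 1 / 32 := by
    rw [← Real.rpow_natCast, ← Real.rpow_mul (by norm_num),
      show -(5 : ℝ) / 2 * ((2 : ℕ) : ℝ) = -((5 : ℕ) : ℝ) by push_cast; ring,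
      Real.rpow_neg (by norm_num), Real.rpow_natCast]
    norm_num
  nlinarith

/-- The clocks are at most `1` at and below the front: `2^{5j/2} ≤ 1` for `j ≤ 0`. -/
theorem wake_clock_le_one {j : ℤ} (hj : j ≤ 0) : (1 + 1 : ℝ) ^ ((5 : ℝ) * (j : ℝ) / 2) ≤ 1 := by
  have : (j : ℝ) ≤ 0 := by exact_mod_cast hj
  exact Real.rpow_le_one_of_one_le_of_nonpos (by norm_num) (by linarith)

/-- `2^{5(j−1)/2} ≤ 1` for `j ≤ 0`. -/
theorem wake_clock_pred_le_one {j : ℤ} (hj : j ≤ 0) :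
    (1 + 1 : ℝ) ^ ((5 : ℝ) * ((j : ℝ) - 1) / 2) ≤ 1 := by
  have : (j : ℝ) ≤ 0 := by exact_mod_cast hj
  exact Real.rpow_le_one_of_one_le_of_nonpos (by norm_num) (by linarith)

/-- `2^{−j} ≥ 16` for `j ≤ −4`. -/
theorem wake_scale_sq_ge {j : ℤ} (hj : j ≤ -4) : (16 : ℝ) ≤ (2 : ℝ) ^ (-(j : ℝ)) := by
  have h : ((4 : ℕ) : ℝ) ≤ -(j : ℝ) := by
    have : (j : ℝ) ≤ -4 := by exact_mod_cast hj
    push_cast; linarith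
  calc (16 : ℝ) = (2 : ℝ) ^ ((4 : ℕ) : ℝ) := by rw [Real.rpow_natCast]; norm_num
    _ ≤ (2 : ℝ) ^ (-(j : ℝ)) := Real.rpow_le_rpow_of_exponent_le (by norm_num) h

/-- `2^{−j} ≥ 1` for `j ≤ 0`. -/
theorem wake_scale_sq_ge_one {j : ℤ} (hj : j ≤ 0) : (1 : ℝ) ≤ (2 : ℝ) ^ (-(j : ℝ)) := by
  have : (j : ℝ) ≤ 0 := by exact_mod_cast hj
  exact Real.one_le_rpow (by norm_num) (by linarith)

/-- One shell down: `2^{−(j−1)} = 2·2^{−j}`. -/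
theorem wake_scale_sq_pred (j : ℤ) : (2 : ℝ) ^ (-(((j - 1 : ℤ)) : ℝ)) = 2 * (2 : ℝ) ^ (-(j : ℝ)) := by
  push_cast
  rw [show -((j : ℝ) - 1) = -(j : ℝ) + 1 by ring, Real.rpow_add (by norm_num), Real.rpow_one]
  ring

/-- One shell up: `2^{−(j+1)} = 2^{−j}/2`. -/
theorem wake_scale_sq_succ (j : ℤ) : (2 : ℝ) ^ (-(((j + 1 : ℤ)) : ℝ)) = (2 : ℝ) ^ (-(j : ℝ)) / 2 := by
  push_cast
  rw [show -((j : ℝ) + 1) = -(j : ℝ) - 1 by ring, Real.rpow_sub (by norm_num), Real.rpow_one]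

/-- `relayEnv₂ (−3) = 16`. -/
theorem relayEnv₂_neg_three : relayEnv₂ (-3) = 16 := by
  unfold relayEnv₂
  rw [if_pos (by norm_num)]
  have : (2 : ℝ) ^ (-(((-3 : ℤ)) : ℝ)) = 8 := by
    rw [show (-(((-3 : ℤ)) : ℝ)) = ((3 : ℕ) : ℝ) by push_cast; ring, Real.rpow_natCast]; norm_num
  rw [this]; norm_num

/-- The wake clause per mode: `wakeE 0 k = 0.02·2^{−k}`, `wakeE 1 k = 0.125·2^{−k}`,
`wakeE 2 k = 0.0032·2^{−k}`. -/
theorem wakeE_zero (k : ℤ) : wakeE 0 k = (2 / 100) * (2 : ℝ) ^ (-(k : ℝ)) := by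
  simp [wakeE]; norm_num

/-- `wakeE 1 k = 0.125·2^{−k}`. -/
theorem wakeE_one (k : ℤ) : wakeE 1 k = (125 / 1000) * (2 : ℝ) ^ (-(k : ℝ)) := by
  simp [wakeE]; norm_num

/-- `wakeE 2 k = 0.0032·2^{−k}`. -/
theorem wakeE_two (k : ℤ) : wakeE 2 k = (32 / 10000) * (2 : ℝ) ^ (-(k : ℝ)) := by
  simp [wakeE]; norm_num

/-- `wakeE i k ≥ 0`. -/
theorem wakeE_nonneg (i : Fin 4) (k : ℤ) : 0 ≤ wakeE i k := by
  unfold wakeE; positivity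

/-- For the active modes `wakeE i k` lies between `0.0032·2^{−k}` and `0.125·2^{−k}`. -/
theorem wakeE_bounds {i : Fin 4} (hi : i ≠ 3) (k : ℤ) :
    (32 / 10000) * (2 : ℝ) ^ (-(k : ℝ)) ≤ wakeE i k ∧ wakeE i k ≤ (125 / 1000) * (2 : ℝ) ^ (-(k : ℝ)) := by
  have hQ : 0 < (2 : ℝ) ^ (-(k : ℝ)) := Real.rpow_pos_of_pos (by norm_num) _
  have hi' : i = 0 ∨ i = 1 ∨ i = 2 := by
    fin_cases i <;> simp_all
  rcases hi' with rfl | rfl | rfl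
  · rw [wakeE_zero]; constructor <;> nlinarith
  · rw [wakeE_one]; constructor <;> nlinarith
  · rw [wakeE_two]; constructor <;> nlinarith

/-! ### Algebra: the three row rates -/

-- triple products: `Literature.Analysis.FluidPDE.WaveKinetic.abs_mul_three_le` (`|abc| ≤ ABC`).

/-- CARRIER ROW RATE: with `Λ = q^{−5}`, `0 ≤ Λ' ≤ 0.177·q^{−5}`, `|x| ≤ 0.26q`, `|u| ≤ 0.65q`,
`|u'| ≤ 0.92q`: `(−Λu² + Λ'u'²)·x ≤ 0.15/q²`. -/
theorem wake_rate_carrier {q Λ Λ' x u u' : ℝ} (hq : 0 < q) (hΛ : Λ = 1 / q ^ 5) (hΛ'0 : 0 ≤ Λ')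
    (hΛ' : Λ' ≤ 177 / 1000 / q ^ 5) (hx : |x| ≤ 26 / 100 * q) (hu : |u| ≤ 65 / 100 * q)
    (hu' : |u'| ≤ 92 / 100 * q) :
    (-(Λ * (u * u)) + Λ' * (u' * u')) * x ≤ 15 / 100 / q ^ 2 := by
  have hΛ0 : 0 ≤ Λ := by rw [hΛ]; positivity
  have h1 := abs_mul_three_le hu hu hx
  have h2 := abs_mul_three_le hu' hu' hx
  have e1 : -(Λ * (u * u * x)) ≤ Λ * (65 / 100 * q * (65 / 100 * q) * (26 / 100 * q)) := by
    have := neg_abs_le (u * u * x)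
    nlinarith
  have e2 : Λ' * (u' * u' * x) ≤ Λ' * (92 / 100 * q * (92 / 100 * q) * (26 / 100 * q)) :=
    mul_le_mul_of_nonneg_left ((le_abs_self _).trans h2) hΛ'0
  have hq3 : Λ' * q ^ 3 ≤ 177 / 1000 / q ^ 2 := by
    calc Λ' * q ^ 3 ≤ 177 / 1000 / q ^ 5 * q ^ 3 := by gcongr
      _ = 177 / 1000 / q ^ 2 := by field_simp
  calc (-(Λ * (u * u)) + Λ' * (u' * u')) * x
      = -(Λ * (u * u * x)) + Λ' * (u' * u' * x) := by ring
    _ ≤ Λ * (65 / 100 * q * (65 / 100 * q) * (26 / 100 * q)) +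
          Λ' * (92 / 100 * q * (92 / 100 * q) * (26 / 100 * q)) := by linarith
    _ = (65 / 100 * (65 / 100) * (26 / 100)) / q ^ 2 +
          (92 / 100 * (92 / 100) * (26 / 100)) * (Λ' * q ^ 3) := by
        rw [hΛ]; field_simp
    _ ≤ (65 / 100 * (65 / 100) * (26 / 100)) / q ^ 2 +
          (92 / 100 * (92 / 100) * (26 / 100)) * (177 / 1000 / q ^ 2) := by gcongr
    _ = (65 / 100 * (65 / 100) * (26 / 100) + 92 / 100 * (92 / 100) * (26 / 100) * (177 / 1000)) /
          q ^ 2 := by ring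
    _ ≤ 15 / 100 / q ^ 2 := div_le_div_of_nonneg_right (by norm_num) (by positivity)

/-- TRIGGER ROW RATE: with `Λ = q^{−5}`, `0 ≤ Λ' ≤ 0.177·q^{−5}`, `|x| ≤ 0.26q`, `|u| ≤ 0.65q`,
`|r| ≤ 0.104q`, `|x⁺| ≤ 1.5q`, `|u'| ≤ 0.92q`, `|r'| ≤ 0.15q`:
`(Λ(xu − ux⁺) − Λx⁺r/32 + Λ'r'u'/32)·u ≤ 0.75/q²`. -/
theorem wake_rate_trigger {q Λ Λ' x u r xp u' r' : ℝ} (hq : 0 < q) (hΛ : Λ = 1 / q ^ 5)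
    (hΛ'0 : 0 ≤ Λ') (hΛ' : Λ' ≤ 177 / 1000 / q ^ 5) (hx : |x| ≤ 26 / 100 * q)
    (hu : |u| ≤ 65 / 100 * q) (hr : |r| ≤ 104 / 1000 * q) (hxp : |xp| ≤ 15 / 10 * q)
    (hu' : |u'| ≤ 92 / 100 * q) (hr' : |r'| ≤ 15 / 100 * q) :
    (Λ * (x * u - u * xp) - 1 / 32 * (Λ * (xp * r)) + 1 / 32 * (Λ' * (r' * u'))) * u ≤
      75 / 100 / q ^ 2 := by
  have hΛ0 : 0 ≤ Λ := by rw [hΛ]; positivity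
  have h1 := abs_mul_three_le hx hu hu
  have h2 := abs_mul_three_le hu hxp hu
  have h3 := abs_mul_three_le hxp hr hu
  have h4 := abs_mul_three_le hr' hu' hu
  have e1 : Λ * (x * u * u) ≤ Λ * (26 / 100 * q * (65 / 100 * q) * (65 / 100 * q)) :=
    mul_le_mul_of_nonneg_left ((le_abs_self _).trans h1) hΛ0
  have e2 : -(Λ * (u * xp * u)) ≤ Λ * (65 / 100 * q * (15 / 10 * q) * (65 / 100 * q)) := by
    have := neg_abs_le (u * xp * u)
    nlinarith
  have e3 : -(1 / 32 * (Λ * (xp * r * u))) ≤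
      1 / 32 * (Λ * (15 / 10 * q * (104 / 1000 * q) * (65 / 100 * q))) := by
    have := neg_abs_le (xp * r * u)
    nlinarith
  have e4 : 1 / 32 * (Λ' * (r' * u' * u)) ≤
      1 / 32 * (Λ' * (15 / 100 * q * (92 / 100 * q) * (65 / 100 * q))) := by
    have := mul_le_mul_of_nonneg_left ((le_abs_self _).trans h4) hΛ'0
    linarith
  have hq3 : Λ' * q ^ 3 ≤ 177 / 1000 / q ^ 2 := by
    calc Λ' * q ^ 3 ≤ 177 / 1000 / q ^ 5 * q ^ 3 := by gcongr
      _ = 177 / 1000 / q ^ 2 := by field_simp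
  calc (Λ * (x * u - u * xp) - 1 / 32 * (Λ * (xp * r)) + 1 / 32 * (Λ' * (r' * u'))) * u
      = Λ * (x * u * u) + -(Λ * (u * xp * u)) + -(1 / 32 * (Λ * (xp * r * u))) +
          1 / 32 * (Λ' * (r' * u' * u)) := by ring
    _ ≤ Λ * (26 / 100 * q * (65 / 100 * q) * (65 / 100 * q)) +
          Λ * (65 / 100 * q * (15 / 10 * q) * (65 / 100 * q)) +
          1 / 32 * (Λ * (15 / 10 * q * (104 / 1000 * q) * (65 / 100 * q))) +
          1 / 32 * (Λ' * (15 / 100 * q * (92 / 100 * q) * (65 / 100 * q))) := by linarith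
    _ = (26 / 100 * (65 / 100) * (65 / 100) + 65 / 100 * (15 / 10) * (65 / 100) +
            1 / 32 * (15 / 10 * (104 / 1000) * (65 / 100))) / q ^ 2 +
          (1 / 32 * (15 / 100 * (92 / 100) * (65 / 100))) * (Λ' * q ^ 3) := by
        rw [hΛ]; field_simp
    _ ≤ (26 / 100 * (65 / 100) * (65 / 100) + 65 / 100 * (15 / 10) * (65 / 100) +
            1 / 32 * (15 / 10 * (104 / 1000) * (65 / 100))) / q ^ 2 +
          (1 / 32 * (15 / 100 * (92 / 100) * (65 / 100))) * (177 / 1000 / q ^ 2) := by gcongr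
    _ = (26 / 100 * (65 / 100) * (65 / 100) + 65 / 100 * (15 / 10) * (65 / 100) +
            1 / 32 * (15 / 10 * (104 / 1000) * (65 / 100)) +
            1 / 32 * (15 / 100 * (92 / 100) * (65 / 100)) * (177 / 1000)) / q ^ 2 := by ring
    _ ≤ 75 / 100 / q ^ 2 := div_le_div_of_nonneg_right (by norm_num) (by positivity)

/-- RELAY ROW RATE: with `Λ = q^{−5}`, `|u| ≤ 0.65q`, `|r| ≤ 0.104q`, `|x⁺|, |u⁺| ≤ 1.5q`:
`(Λ(x⁺u − uu⁺)/32)·r ≤ 0.007/q²`. -/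
theorem wake_rate_relay {q Λ u r xp up : ℝ} (hq : 0 < q) (hΛ : Λ = 1 / q ^ 5)
    (hu : |u| ≤ 65 / 100 * q) (hr : |r| ≤ 104 / 1000 * q) (hxp : |xp| ≤ 15 / 10 * q)
    (hup : |up| ≤ 15 / 10 * q) :
    1 / 32 * (Λ * (xp * u - u * up)) * r ≤ 7 / 1000 / q ^ 2 := by
  have hΛ0 : 0 ≤ Λ := by rw [hΛ]; positivity
  have h1 := abs_mul_three_le hxp hu hr
  have h2 := abs_mul_three_le hu hup hr
  have e1 : Λ * (xp * u * r) ≤ Λ * (15 / 10 * q * (65 / 100 * q) * (104 / 1000 * q)) :=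
    mul_le_mul_of_nonneg_left ((le_abs_self _).trans h1) hΛ0
  have e2 : -(Λ * (u * up * r)) ≤ Λ * (65 / 100 * q * (15 / 10 * q) * (104 / 1000 * q)) := by
    have := neg_abs_le (u * up * r)
    nlinarith
  calc 1 / 32 * (Λ * (xp * u - u * up)) * r
      = 1 / 32 * (Λ * (xp * u * r) + -(Λ * (u * up * r))) := by ring
    _ ≤ 1 / 32 * (Λ * (15 / 10 * q * (65 / 100 * q) * (104 / 1000 * q)) +
          Λ * (65 / 100 * q * (15 / 10 * q) * (104 / 1000 * q))) := by linarith
    _ = (1 / 32 * (15 / 10 * (65 / 100) * (104 / 1000) + 65 / 100 * (15 / 10) * (104 / 1000))) /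
          q ^ 2 := by rw [hΛ]; field_simp
    _ ≤ 7 / 1000 / q ^ 2 := div_le_div_of_nonneg_right (by norm_num) (by positivity)

/-- CRUDE RATES (for the uniform growth constant): with all amplitudes `≤ M` and clocks `≤ 1`,
`quadTerm·S ≤ 3M³` in each active row. -/
theorem wake_crude_carrier {Λ Λ' x u u' M : ℝ} (hΛ0 : 0 ≤ Λ) (hΛ : Λ ≤ 1) (hΛ'0 : 0 ≤ Λ')
    (hΛ' : Λ' ≤ 1) (hx : |x| ≤ M) (hu : |u| ≤ M) (hu' : |u'| ≤ M) :
    (-(Λ * (u * u)) + Λ' * (u' * u')) * x ≤ 3 * M ^ 3 := by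
  have hM : 0 ≤ M := (abs_nonneg x).trans hx
  have h1 := abs_mul_three_le hu hu hx
  have h2 := abs_mul_three_le hu' hu' hx
  have e1 : -(Λ * (u * u * x)) ≤ Λ * (M * M * M) := by
    have := neg_abs_le (u * u * x)
    nlinarith
  have e2 : Λ' * (u' * u' * x) ≤ Λ' * (M * M * M) :=
    mul_le_mul_of_nonneg_left ((le_abs_self _).trans h2) hΛ'0
  have hM3 : 0 ≤ M * M * M := by positivity
  calc (-(Λ * (u * u)) + Λ' * (u' * u')) * x = -(Λ * (u * u * x)) + Λ' * (u' * u' * x) := by ring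
    _ ≤ Λ * (M * M * M) + Λ' * (M * M * M) := by linarith
    _ ≤ 1 * (M * M * M) + 1 * (M * M * M) := by gcongr
    _ ≤ 3 * M ^ 3 := by nlinarith

/-- Crude trigger-row rate: `quadTerm·S ≤ 3M³` when all amplitudes are `≤ M` and the clocks `≤ 1`. -/
theorem wake_crude_trigger {Λ Λ' x u r xp u' r' M : ℝ} (hΛ0 : 0 ≤ Λ) (hΛ : Λ ≤ 1) (hΛ'0 : 0 ≤ Λ')
    (hΛ' : Λ' ≤ 1) (hx : |x| ≤ M) (hu : |u| ≤ M) (hr : |r| ≤ M) (hxp : |xp| ≤ M) (hu' : |u'| ≤ M)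
    (hr' : |r'| ≤ M) :
    (Λ * (x * u - u * xp) - 1 / 32 * (Λ * (xp * r)) + 1 / 32 * (Λ' * (r' * u'))) * u ≤ 3 * M ^ 3 := by
  have hM : 0 ≤ M := (abs_nonneg x).trans hx
  have h1 := abs_mul_three_le hx hu hu
  have h2 := abs_mul_three_le hu hxp hu
  have h3 := abs_mul_three_le hxp hr hu
  have h4 := abs_mul_three_le hr' hu' hu
  have e1 : Λ * (x * u * u) ≤ Λ * (M * M * M) :=
    mul_le_mul_of_nonneg_left ((le_abs_self _).trans h1) hΛ0
  have e2 : -(Λ * (u * xp * u)) ≤ Λ * (M * M * M) := by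
    have := neg_abs_le (u * xp * u)
    nlinarith
  have e3 : -(1 / 32 * (Λ * (xp * r * u))) ≤ 1 / 32 * (Λ * (M * M * M)) := by
    have := neg_abs_le (xp * r * u)
    nlinarith
  have e4 : 1 / 32 * (Λ' * (r' * u' * u)) ≤ 1 / 32 * (Λ' * (M * M * M)) := by
    have := mul_le_mul_of_nonneg_left ((le_abs_self _).trans h4) hΛ'0
    linarith
  have hM3 : 0 ≤ M * M * M := by positivity
  calc (Λ * (x * u - u * xp) - 1 / 32 * (Λ * (xp * r)) + 1 / 32 * (Λ' * (r' * u'))) * u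
      = Λ * (x * u * u) + -(Λ * (u * xp * u)) + -(1 / 32 * (Λ * (xp * r * u))) +
          1 / 32 * (Λ' * (r' * u' * u)) := by ring
    _ ≤ Λ * (M * M * M) + Λ * (M * M * M) + 1 / 32 * (Λ * (M * M * M)) +
          1 / 32 * (Λ' * (M * M * M)) := by linarith
    _ ≤ 1 * (M * M * M) + 1 * (M * M * M) + 1 / 32 * (1 * (M * M * M)) +
          1 / 32 * (1 * (M * M * M)) := by gcongr
    _ ≤ 3 * M ^ 3 := by nlinarith

/-- Crude relay-row rate: `quadTerm·S ≤ 3M³` when all amplitudes are `≤ M` and the clock `≤ 1`. -/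
theorem wake_crude_relay {Λ u r xp up M : ℝ} (hΛ0 : 0 ≤ Λ) (hΛ : Λ ≤ 1) (hu : |u| ≤ M)
    (hr : |r| ≤ M) (hxp : |xp| ≤ M) (hup : |up| ≤ M) :
    1 / 32 * (Λ * (xp * u - u * up)) * r ≤ 3 * M ^ 3 := by
  have hM : 0 ≤ M := (abs_nonneg u).trans hu
  have h1 := abs_mul_three_le hxp hu hr
  have h2 := abs_mul_three_le hu hup hr
  have e1 : Λ * (xp * u * r) ≤ Λ * (M * M * M) :=
    mul_le_mul_of_nonneg_left ((le_abs_self _).trans h1) hΛ0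
  have e2 : -(Λ * (u * up * r)) ≤ Λ * (M * M * M) := by
    have := neg_abs_le (u * up * r)
    nlinarith
  have hM3 : 0 ≤ M * M * M := by positivity
  calc 1 / 32 * (Λ * (xp * u - u * up)) * r
      = 1 / 32 * (Λ * (xp * u * r) + -(Λ * (u * up * r))) := by ring
    _ ≤ 1 / 32 * (Λ * (M * M * M) + Λ * (M * M * M)) := by linarith
    _ ≤ 1 / 32 * (1 * (M * M * M) + 1 * (M * M * M)) := by gcongr
    _ ≤ 3 * M ^ 3 := by nlinarith

end Summit.NavierStokesRegularity.NavierStokesRegularity.Cruxes.RelayFrontStep.Window2
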